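import Mathlib.Analysis.InnerProductSpace.Adjoint
import Mathlib.Analysis.Distribution.SchwartzSpace.Basic
import Literature.MathematicalPhysics.QuantumLattice.MinkowskiGeometry
import Literature.MathematicalPhysics.QuantumLattice.SchwartzTensor
import Literature.Analysis.UnboundedOperators.UnitaryRep
import Literature.Analysis.UnboundedOperators.FourierSpectrum
import Literature.MathematicalPhysics.QuantumFieldTheory.MassGap
import HarnessLib

-- provenance: harness21/H21/H21/Prelude/QLatticeAQFT/WightmanAxioms.lean @ 966583b (interim HEAD d8f2665); M5 mechanical rewrite
/-!
# The Wightman axioms for hermitian scalar fields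

Trunk `QLatticeAQFT` (G13), item A16 / notion `wightman_axioms`, outline decisions A-D4, A-D5.

A *Wightman quantum field theory* of hermitian scalar fields `φ_k`, `k : κ`, on
`(d+1)`-dimensional Minkowski space consists of (Streater–Wightman §3-1; Jaffe–Witten §5):

* **W0 (relativistic quantum theory).** A separable complex Hilbert space `H`, a strongly
  continuous unitary representation `U(a, Λ)` of the (restricted) Poincaré group, whose translation
  part `U(a, 1) = ∫ e^{i p·a} dE(p)` has spectral measure supported in the closed forward light
  cone (spectral condition), and a unique (up to phase) invariant unit vector `Ω`, the vacuum.
* **W1 (fields).** A dense subspace `D ⊆ H` containing `Ω` and invariant under `U`, and for each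
  test function `f ∈ 𝓢(ℝ^{1+d})` operators `φ_k(f) : D → D`, linear in `f`, such that
  `⟪χ, φ_k(f) ψ⟫` is a tempered distribution in `f` and `φ_k(f)* ⊇ φ_k(f̄)` (hermitian fields).
* **W2 (covariance).** `U(a, Λ) φ_k(f) U(a, Λ)⁻¹ = φ_k({a, Λ} f)` on `D`, where
  `({a, Λ} f)(x) = f(Λ⁻¹ (x - a))` (scalar fields: trivial finite-dimensional representation).
* **W3 (locality).** If the supports of `f` and `g` are spacelike separated then
  `[φ_k(f), φ_{k'}(g)] = 0` on `D`.
* **W4 (cyclicity).** The span of `φ_{k₁}(f₁) ⋯ φ_{kₙ}(fₙ) Ω` is dense in `H`.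

We bundle the *data* as `WightmanData d κ` and the *axioms* as the `Prop`-valued structure
`IsWightmanQFT W` (a hypothesis structure, outline A-D5), and define the Wightman functions
`wightmanFn W n k f = ⟪Ω, φ_{k₁}(f₁) ⋯ φ_{kₙ}(fₙ) Ω⟫`, the mass gap `WightmanData.HasMassGap`
(through G07's `UnitaryRep.HasMassGapWithUniqueVacuum` applied to the translations) and unitary
equivalence of Wightman data.

**Scope (outline R10).** v0 covers scalar hermitian fields transforming under a *true*
representation of the restricted Lorentz group `L↑₊ = restrictedLorentzGroup d`; there are no
spinor / tensor fields and no universal cover `SL(2, ℂ)` (Streater–Wightman use `ISL(2, ℂ)`).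
Separability of `H` is not recorded (it follows from W4 for countable `κ`, Streater–Wightman
§3-1, remark after W4, and no target statement uses it).

Sources: R. F. Streater, A. S. Wightman, *PCT, Spin and Statistics, and All That* (1964), §3-1
(the axioms), §3-3 (Wightman functions), §3-4 (hermiticity, positivity); A. Jaffe, E. Witten,
*Quantum Yang–Mills theory*, Clay problem description (2000), §5; R. Haag, *Local Quantum
Physics* (1996), §II.1.

## Mathlib

Mathlib (pinned) has Hilbert spaces, `unitary (H →L[ℂ] H)`, `Submodule`, `LinearPMap`,
`LinearIsometryEquiv`, the Schwartz space `𝓢(E, ℂ)` with its topology, `tsupport`, `Dense`,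
`Submodule.span`; it has no Wightman axioms, quantum fields or Poincaré representations
(searched `Wightman`, `quantum field`, `Poincare` in `Analysis/`, `rg -i wightman`: no hits).
Everything below is a thin layer over these anchors and over the accepted H21 modules
`MinkowskiGeometry` (`SpaceTime`, `restrictedLorentzGroup`, `PoincareGroup`, `poincareTest`,
`closedForwardCone`, `AreSpacelikeSeparated`), `SchwartzTensor` (`AQFT.starTest`), G07 `UnitaryRep`
(`HasUniqueVacuum`), `FourierSpectrum` (`HasFourierSpectrumIn`) and the constructive-QFT statement
file `MassGap` (`UnitaryRep.HasMassGapWithUniqueVacuum`, `timeTranslations`).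

## Design choices

* `WightmanData` carries the Hilbert space as a field `H : Type` with its instances as
  instance-implicit fields (re-exported by `attribute [instance]`), the translations as a G07
  `UnitaryRep (Multiplicative (SpaceTime d)) H` and the Lorentz part as a bare homomorphism
  `restrictedLorentzGroup d →* unitary (H →L[ℂ] H)`; the two are tied by the semidirect-product
  relation `IsWightmanQFT.lor_transl`, so that `WightmanData.U g = lor Λ * transl a` for
  `g = (a, Λ)` is a representation of `PoincareGroup d` (`IsWightmanQFT.U_mul`). No topology is put
  on the Poincaré group (A-D4); strong continuity of the Lorentz part refers to the topology on
  `restrictedLorentzGroup d` induced by the operator norm on `SpaceTime d →L[ℝ] SpaceTime d`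
  (the matrix topology on `SO↑(1, d)`), provided here as an instance on the H21 type
  `↥(restrictedLorentzGroup d)` (Mathlib has no topology on `E ≃L[ℝ] E`; nothing is overridden).
* The single well-formedness condition `vacuum_mem : vacuum ∈ dom` is a (`Prop`) field of
  `WightmanData` rather than of `IsWightmanQFT` (a deviation from the outline, in the spirit of
  `UnitaryRep.mem_unitary`): it is needed to *define* the Wightman functions
  `⟪Ω, φ(f₁) ⋯ φ(fₙ) Ω⟫` without a junk value.
* Fields are maps `field k : 𝓢(SpaceTime d, ℂ) →ₗ[ℂ] (dom →ₗ[ℂ] dom)` on the common invariant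
  domain (Streater–Wightman's `D`); `smearedField` repackages `φ_k(f)` as a Mathlib `LinearPMap`
  on `H` with domain `dom`. Test functions are complex-valued; hermiticity is
  `⟪χ, φ(f) ψ⟫ = conj ⟪ψ, φ(f̄) χ⟫` with `f̄ = AQFT.starTest f`.
* In `covariant` and `IsUnitarilyEquivalent` the membership of the transported vector in the
  domain is taken as an explicit hypothesis `hψ` (any proof will do, by proof irrelevance); under
  `IsWightmanQFT` it is supplied by `IsWightmanQFT.U_mem_dom`.
* The vacuum is normalised, `‖Ω‖ = 1` (Streater–Wightman W0), although G07's `IsVacuum` is not.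
* `HasMassGap W Δ` is *literally* `W.transl.HasMassGapWithUniqueVacuum W.vacuum Δ`; the
  bookkeeping `SpaceTime d = EuclideanSpace ℝ (Fin (d + 1))` is `rfl`, time is coordinate `0` on
  both sides.
-/

noncomputable section

open Filter Topology ComplexConjugate
open scoped InnerProductSpace SchwartzMap

namespace Literature.MathematicalPhysics.QuantumLattice

variable {d : ℕ} {κ : Type*}

/-! ### Topology on the restricted Lorentz group -/

/-- The topology on the restricted Lorentz group `L↑₊` induced by the operator-norm topology on
`SpaceTime d →L[ℝ] SpaceTime d` (the usual matrix topology on `SO↑(1, d)`; Streater–Wightman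
(1964), §1-1). Mathlib puts no topology on `E ≃L[ℝ] E`, so this instance overrides nothing. [folklore] -/
instance restrictedLorentzGroup.instTopologicalSpace :
    TopologicalSpace (restrictedLorentzGroup d) :=
  TopologicalSpace.induced
    (fun Λ => ((Λ : SpaceTime d ≃L[ℝ] SpaceTime d) : SpaceTime d →L[ℝ] SpaceTime d))
    inferInstance

/-- The coercion `L↑₊ → (SpaceTime d →L[ℝ] SpaceTime d)` is continuous (by definition of the
induced topology). [folklore] -/
theorem restrictedLorentzGroup.continuous_coe :
    Continuous fun Λ : restrictedLorentzGroup d =>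
      ((Λ : SpaceTime d ≃L[ℝ] SpaceTime d) : SpaceTime d →L[ℝ] SpaceTime d) :=
  continuous_induced_dom

/-! ### Wightman data -/

/-- **Wightman data** for hermitian scalar fields indexed by `κ` on `(d+1)`-dimensional Minkowski
space: a complex Hilbert space `H`, a strongly continuous unitary representation `transl` of the
translation group `ℝ^{1+d}`, a unitary representation `lor` of the restricted Lorentz group
`L↑₊`, a vacuum vector `Ω`, a common domain `D = dom` containing `Ω`, and the smeared field
operators `φ_k(f) : D → D`, linear in the complex test function `f ∈ 𝓢(ℝ^{1+d}, ℂ)`. The axioms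
are `IsWightmanQFT` (Streater–Wightman (1964), §3-1; Jaffe–Witten (2000), §5). No spinor fields
and no `SL(2, ℂ)` cover in v0. [cite: StreaterWightman1964] -/
structure WightmanData (d : ℕ) (κ : Type*) where
  /-- The Hilbert space of states. -/
  H : Type
  [instNormedAddCommGroup : NormedAddCommGroup H]
  [instInnerProductSpace : InnerProductSpace ℂ H]
  [instCompleteSpace : CompleteSpace H]
  /-- The unitary representation `a ↦ U(a, 1)` of space-time translations. -/
  transl : Literature.Analysis.UnboundedOperators.UnitaryRep (Multiplicative (SpaceTime d)) H
  /-- The unitary representation `Λ ↦ U(0, Λ)` of the restricted Lorentz group. -/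
  lor : restrictedLorentzGroup d →* unitary (H →L[ℂ] H)
  /-- The vacuum vector `Ω`. -/
  vacuum : H
  /-- The common dense invariant domain `D` of the field operators. -/
  dom : Submodule ℂ H
  /-- The vacuum lies in the domain, `Ω ∈ D`. -/
  vacuum_mem : vacuum ∈ dom
  /-- The smeared fields `f ↦ φ_k(f) : D → D`, complex-linear in the test function. -/
  field : κ → 𝓢(SpaceTime d, ℂ) →ₗ[ℂ] (dom →ₗ[ℂ] dom)

attribute [instance] WightmanData.instNormedAddCommGroup WightmanData.instInnerProductSpace
  WightmanData.instCompleteSpace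

namespace WightmanData

variable (W : WightmanData d κ)

/-- The vacuum as an element of the domain `D` (Streater–Wightman (1964), §3-1, W1). [cite: StreaterWightman1964] -/
def vacuumDom : W.dom := ⟨W.vacuum, W.vacuum_mem⟩

/-- `↑W.vacuumDom = W.vacuum`. [folklore] -/
@[simp]
theorem coe_vacuumDom : (W.vacuumDom : W.H) = W.vacuum := rfl

/-- The operator `U(a, Λ) := U(a, 1) U(0, Λ) = transl a * lor Λ` attached to an element
`g = (a, Λ)` of the Poincaré group `ℝ^{1+d} ⋊ L↑₊` (which acts on space-time by `x ↦ Λ x + a`,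
first `Λ` then the translation); under `IsWightmanQFT.lor_transl` this is a unitary
representation of `PoincareGroup d`, `IsWightmanQFT.U_mul` (Streater–Wightman (1964), §3-1,
eq. (3-2)). (The order `transl * lor` is forced by Mathlib's semidirect-product law
`(a, Λ)(a', Λ') = (a + Λ a', Λ Λ')`.) [cite: StreaterWightman1964] -/
def U (g : PoincareGroup d) : W.H →L[ℂ] W.H :=
  W.transl g.left * (W.lor g.right : W.H →L[ℂ] W.H)

/-- On a pure translation, `U (a, 1) = transl a`. [folklore] -/
@[simp]
theorem U_inl (a : Multiplicative (SpaceTime d)) :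
    W.U (SemidirectProduct.inl a) = W.transl a := by
  simp [U]

/-- On a pure Lorentz transformation, `U (0, Λ) = lor Λ`. [folklore] -/
@[simp]
theorem U_inr (Λ : restrictedLorentzGroup d) :
    W.U (SemidirectProduct.inr Λ) = (W.lor Λ : W.H →L[ℂ] W.H) := by
  simp [U]

/-- `U(1) = 1`. [folklore] -/
@[simp]
theorem U_one : W.U 1 = 1 := by
  simp [U]

/-- `U g` is a unitary operator (product of unitaries). [folklore] -/
theorem U_mem_unitary (g : PoincareGroup d) : W.U g ∈ unitary (W.H →L[ℂ] W.H) :=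
  Submonoid.mul_mem _ (W.transl.mem_unitary g.left) (W.lor g.right).2

/-- The smeared field `φ_k(f)` as a partially defined (unbounded) operator on `H` with domain `D`
(Mathlib `LinearPMap`; Streater–Wightman (1964), §3-1, W1). [cite: StreaterWightman1964] -/
def smearedField (k : κ) (f : 𝓢(SpaceTime d, ℂ)) : W.H →ₗ.[ℂ] W.H where
  domain := W.dom
  toFun := W.dom.subtype ∘ₗ W.field k f

/-- The domain of `φ_k(f)` is `D`. [folklore] -/
@[simp]
theorem smearedField_domain (k : κ) (f : 𝓢(SpaceTime d, ℂ)) :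
    (W.smearedField k f).domain = W.dom := rfl

/-- `φ_k(f) ψ = field k f ψ` for `ψ ∈ D`. [folklore] -/
@[simp]
theorem smearedField_apply (k : κ) (f : 𝓢(SpaceTime d, ℂ)) (ψ : W.dom) :
    W.smearedField k f ψ = (W.field k f ψ : W.H) := rfl

/-- The *field monomial* `φ_{k₁}(f₁) φ_{k₂}(f₂) ⋯ φ_{kₙ}(fₙ) : D → D` attached to a list
`[(k₁, f₁), …, (kₙ, fₙ)]` (the empty list gives the identity)
(Streater–Wightman (1964), §3-1, W4, and §3-3). [cite: StreaterWightman1964] -/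
def fieldMonomial (l : List (κ × 𝓢(SpaceTime d, ℂ))) : W.dom →ₗ[ℂ] W.dom :=
  l.foldr (fun p A => W.field p.1 p.2 ∘ₗ A) LinearMap.id

/-- The empty monomial is the identity. [folklore] -/
@[simp]
theorem fieldMonomial_nil : W.fieldMonomial [] = LinearMap.id := rfl

/-- `fieldMonomial ((k, f) :: l) = φ_k(f) ∘ fieldMonomial l`. [folklore] -/
@[simp]
theorem fieldMonomial_cons (p : κ × 𝓢(SpaceTime d, ℂ)) (l : List (κ × 𝓢(SpaceTime d, ℂ))) :
    W.fieldMonomial (p :: l) = W.field p.1 p.2 ∘ₗ W.fieldMonomial l := rfl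

/-- The `n`-point **Wightman function** smeared with one-point test functions,
`𝔚ₙ(f₁, …, fₙ) = ⟪Ω, φ_{k₁}(f₁) ⋯ φ_{kₙ}(fₙ) Ω⟫` (Streater–Wightman (1964), §3-3, eq. (3-19);
the inner product is conjugate-linear in the first slot, Mathlib's convention). [cite: StreaterWightman1964] -/
def wightmanFn (n : ℕ) (k : Fin n → κ) (f : Fin n → 𝓢(SpaceTime d, ℂ)) : ℂ :=
  ⟪W.vacuum, (W.fieldMonomial (List.ofFn fun i => (k i, f i)) W.vacuumDom : W.H)⟫_ℂ

/-- The Wightman data `W` have **mass gap** `Δ`: `Ω` is the unique translation-invariant vector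
and the time translations `U(t e₀, 1) = e^{itH}` have Hamiltonian `H ≥ 0` with `H Ω = 0`, `0` a
simple eigenvalue and `σ(H) ∖ {0} ⊆ [Δ, ∞)`, `0 < Δ` — literally G07's
`UnitaryRep.HasMassGapWithUniqueVacuum` for `W.transl` (`SpaceTime d = EuclideanSpace ℝ
(Fin (d + 1))` by `rfl`, time = coordinate `0`) (Jaffe–Witten (2000), §5 and p. 6;
Streater–Wightman (1964), §3-1). [cite: JaffeWitten2000] -/
def HasMassGap (Δ : ℝ) : Prop :=
  W.transl.HasMassGapWithUniqueVacuum W.vacuum Δ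

/-- Two Wightman data are **unitarily equivalent** if there is a unitary `V : H ≃ H'` mapping
vacuum to vacuum, domain onto domain, and intertwining translations, Lorentz transformations and
fields (Streater–Wightman (1964), §3-4, uniqueness in the reconstruction theorem, Thm. 3-7). The
membership `V ψ ∈ D'` in the last clause is an explicit hypothesis (it follows from `map_dom`). [cite: StreaterWightman1964] -/
def IsUnitarilyEquivalent (W W' : WightmanData d κ) : Prop :=
  ∃ V : W.H ≃ₗᵢ[ℂ] W'.H,
    V W.vacuum = W'.vacuum ∧
    (∀ a ψ, V (W.transl a ψ) = W'.transl a (V ψ)) ∧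
    (∀ Λ ψ, V ((W.lor Λ : W.H →L[ℂ] W.H) ψ) = (W'.lor Λ : W'.H →L[ℂ] W'.H) (V ψ)) ∧
    Submodule.map (V.toLinearEquiv : W.H →ₗ[ℂ] W'.H) W.dom = W'.dom ∧
    ∀ (k : κ) (f : 𝓢(SpaceTime d, ℂ)) (ψ : W.dom) (hψ : V ψ ∈ W'.dom),
      V (W.field k f ψ) = W'.field k f ⟨V ψ, hψ⟩

/-- Unitary equivalence is reflexive (take `V = id`). [folklore] -/
theorem IsUnitarilyEquivalent.refl (W : WightmanData d κ) : W.IsUnitarilyEquivalent W := by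
  refine ⟨LinearIsometryEquiv.refl ℂ W.H, rfl, fun _ _ => rfl, fun _ _ => rfl, ?_,
    fun _ _ _ _ => rfl⟩
  ext ψ
  simp only [Submodule.mem_map_equiv]
  exact Iff.rfl

end WightmanData

/-! ### The Wightman axioms -/

/-- **The Wightman axioms** W0–W4 for the Wightman data `W` of hermitian scalar fields
(Streater–Wightman (1964), §3-1; Jaffe–Witten (2000), §5). W0: strong continuity of the Lorentz
part, the semidirect-product relation `U(Λ) U(a) U(Λ)⁻¹ = U(Λ a)`, the spectral condition
(Fourier spectrum of the translations in the closed forward cone `V̄₊`), uniqueness, Lorentz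
invariance and normalisation of the vacuum; W1: dense common domain, invariant under `U`, fields
tempered distributions in `f` with hermiticity `φ(f)* ⊇ φ(f̄)`; W2: Poincaré covariance of scalar
fields; W3: locality (commutativity at spacelike separation); W4: cyclicity of the vacuum. [cite: StreaterWightman1964] -/
structure IsWightmanQFT (W : WightmanData d κ) : Prop where
  -- W0: relativistic invariance, spectral condition, vacuum
  /-- W0: the Lorentz part `Λ ↦ U(0, Λ) ψ` is strongly continuous. -/
  strongCont_lor : ∀ ψ : W.H,
    Continuous fun Λ : restrictedLorentzGroup d => (W.lor Λ : W.H →L[ℂ] W.H) ψ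
  /-- W0: the semidirect-product relation `U(0, Λ) U(a, 1) U(0, Λ)⁻¹ = U(Λ a, 1)`, making
  `(a, Λ) ↦ U(0, Λ) U(a, 1)` a representation of the Poincaré group. -/
  lor_transl : ∀ (Λ : restrictedLorentzGroup d) (a : Multiplicative (SpaceTime d)),
    (W.lor Λ : W.H →L[ℂ] W.H) * W.transl a * (W.lor Λ⁻¹ : W.H →L[ℂ] W.H) =
      W.transl (lorentzAct d Λ a)
  /-- W0, spectral condition: the energy–momentum spectrum lies in the closed forward cone. -/
  spectral : W.transl.HasFourierSpectrumIn (closedForwardCone d)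
  /-- W0: `Ω` is, up to scalars, the unique translation-invariant vector. -/
  uniqueVacuum : W.transl.HasUniqueVacuum W.vacuum
  /-- W0: the vacuum is Lorentz invariant. -/
  lor_vacuum : ∀ Λ : restrictedLorentzGroup d, (W.lor Λ : W.H →L[ℂ] W.H) W.vacuum = W.vacuum
  /-- W0: the vacuum is a unit vector. -/
  norm_vacuum : ‖W.vacuum‖ = 1
  -- W1: domain and continuity of the fields
  /-- W1: the domain `D` is dense. -/
  dense_dom : Dense (W.dom : Set W.H)
  /-- W1: `D` is invariant under translations. -/
  transl_dom : ∀ (a : Multiplicative (SpaceTime d)) (ψ : W.H), ψ ∈ W.dom → W.transl a ψ ∈ W.dom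
  /-- W1: `D` is invariant under Lorentz transformations. -/
  lor_dom : ∀ (Λ : restrictedLorentzGroup d) (ψ : W.H),
    ψ ∈ W.dom → (W.lor Λ : W.H →L[ℂ] W.H) ψ ∈ W.dom
  /-- W1: for `ψ, χ ∈ D`, `f ↦ ⟪χ, φ_k(f) ψ⟫` is a tempered distribution. -/
  tempered : ∀ (k : κ) (ψ χ : W.dom),
    Continuous fun f : 𝓢(SpaceTime d, ℂ) => ⟪(χ : W.H), (W.field k f ψ : W.H)⟫_ℂ
  /-- W1, hermitian fields: `⟪χ, φ_k(f) ψ⟫ = conj ⟪ψ, φ_k(f̄) χ⟫`, i.e. `φ_k(f)* ⊇ φ_k(f̄)`. -/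
  hermitian : ∀ (k : κ) (f : 𝓢(SpaceTime d, ℂ)) (ψ χ : W.dom),
    ⟪(χ : W.H), (W.field k f ψ : W.H)⟫_ℂ =
      conj ⟪(ψ : W.H), (W.field k (QuantumLattice.starTest f) χ : W.H)⟫_ℂ
  -- W2: covariance
  /-- W2, Poincaré covariance of scalar fields: `U(g) φ_k(f) ψ = φ_k(g • f) U(g) ψ` for `ψ ∈ D`,
  with `(g • f)(x) = f(Λ⁻¹(x - a))`. The membership `U(g) ψ ∈ D` is any proof (see
  `IsWightmanQFT.U_mem_dom`). -/
  covariant : ∀ (g : PoincareGroup d) (k : κ) (f : 𝓢(SpaceTime d, ℂ)) (ψ : W.dom)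
    (hψ : W.U g ψ ∈ W.dom),
    W.U g (W.field k f ψ : W.H) = (W.field k (poincareTest g f) ⟨W.U g ψ, hψ⟩ : W.H)
  -- W3: locality
  /-- W3, locality (microscopic causality): fields smeared with spacelike-separated test
  functions commute on `D`. -/
  locality : ∀ (k k' : κ) (f g : 𝓢(SpaceTime d, ℂ)) (ψ : W.dom),
    AreSpacelikeSeparated (tsupport f) (tsupport g) →
      W.field k f (W.field k' g ψ) = W.field k' g (W.field k f ψ)
  -- W4: cyclicity
  /-- W4, cyclicity of the vacuum: polynomials in the smeared fields applied to `Ω` span a dense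
  subspace of `H`. -/
  cyclic : Dense ((Submodule.span ℂ (Set.range fun l : List (κ × 𝓢(SpaceTime d, ℂ)) =>
    (W.fieldMonomial l W.vacuumDom : W.H))) : Set W.H)

namespace IsWightmanQFT

variable {W : WightmanData d κ}

/-- Under the Wightman axioms `D` is invariant under the full Poincaré action `U(g)`. [folklore] -/
theorem U_mem_dom (hW : IsWightmanQFT W) (g : PoincareGroup d) {ψ : W.H} (hψ : ψ ∈ W.dom) :
    W.U g ψ ∈ W.dom :=
  hW.transl_dom _ _ (hW.lor_dom _ _ hψ)

/-- Under the Wightman axioms `g ↦ U(g) = U(a, 1) U(0, Λ)` is a homomorphism of the Poincaré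
group: `U(g h) = U(g) U(h)` (from `lor_transl`; Streater–Wightman (1964), §3-1, eq. (3-2)). [cite: StreaterWightman1964] -/
theorem U_mul (hW : IsWightmanQFT W) (g h : PoincareGroup d) : W.U (g * h) = W.U g * W.U h := by
  have key : (W.lor g.right : W.H →L[ℂ] W.H) * W.transl h.left =
      W.transl (lorentzAct d g.right h.left) * (W.lor g.right : W.H →L[ℂ] W.H) := by
    rw [← hW.lor_transl g.right h.left, mul_assoc, ← Submonoid.coe_mul, ← map_mul,
      inv_mul_cancel, map_one, Submonoid.coe_one, mul_one]
  simp only [WightmanData.U, SemidirectProduct.mul_left, SemidirectProduct.mul_right, map_mul,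
    Submonoid.coe_mul]
  rw [mul_assoc, mul_assoc, ← mul_assoc _ (W.transl h.left), key, mul_assoc]

/-- `U(g)⁻¹ = U(g⁻¹)` in the unitary group: `U(g⁻¹) U(g) = 1`. [folklore] -/
theorem U_inv_mul (hW : IsWightmanQFT W) (g : PoincareGroup d) : W.U g⁻¹ * W.U g = 1 := by
  rw [← hW.U_mul, inv_mul_cancel, WightmanData.U_one]

/-- The vacuum is Poincaré invariant: `U(g) Ω = Ω`. [folklore] -/
theorem U_vacuum (hW : IsWightmanQFT W) (g : PoincareGroup d) : W.U g W.vacuum = W.vacuum := by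
  have ht : W.transl g.left W.vacuum = W.vacuum :=
    (W.transl.mem_invariantVectors_iff W.vacuum).1 hW.uniqueVacuum.1.1 g.left
  simp [WightmanData.U, ht, hW.lor_vacuum]

/-- Covariance of field monomials: `U(g) φ(f₁) ⋯ φ(fₙ) ψ = φ(g • f₁) ⋯ φ(g • fₙ) U(g) ψ` on `D`
(iterate W2). [folklore] -/
theorem U_fieldMonomial (hW : IsWightmanQFT W) (g : PoincareGroup d)
    (l : List (κ × 𝓢(SpaceTime d, ℂ))) (ψ : W.dom) :
    W.U g (W.fieldMonomial l ψ : W.H) =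
      (W.fieldMonomial (l.map fun p => (p.1, poincareTest g p.2))
        ⟨W.U g ψ, hW.U_mem_dom g ψ.2⟩ : W.H) := by
  induction l with
  | nil => rfl
  | cons p l ih =>
    simp only [WightmanData.fieldMonomial_cons, List.map_cons, LinearMap.comp_apply]
    rw [hW.covariant g p.1 p.2 _ (hW.U_mem_dom g (W.fieldMonomial l ψ).2)]
    congr 2
    exact Subtype.ext ih

/-- **Poincaré invariance of the Wightman functions**: `𝔚ₙ(g • f₁, …, g • fₙ) = 𝔚ₙ(f₁, …, fₙ)`
for every `g` in the restricted Poincaré group (Streater–Wightman (1964), §3-3, eq. (3-21): W2,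
unitarity of `U(g)` and invariance of `Ω`). [cite: StreaterWightman1964] -/
theorem wightmanFn_poincare_invariant (hW : IsWightmanQFT W) (n : ℕ) (k : Fin n → κ)
    (f : Fin n → 𝓢(SpaceTime d, ℂ)) (g : PoincareGroup d) :
    W.wightmanFn n k (fun i => poincareTest g (f i)) = W.wightmanFn n k f := by
  have h1 := hW.U_fieldMonomial g (List.ofFn fun i => (k i, f i)) W.vacuumDom
  rw [List.map_ofFn] at h1
  have h2 : (W.fieldMonomial (List.ofFn fun i => (k i, poincareTest g (f i))) W.vacuumDom : W.H)
      = W.U g (W.fieldMonomial (List.ofFn fun i => (k i, f i)) W.vacuumDom : W.H) := by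
    rw [h1]
    congr 2
    exact (Subtype.ext (hW.U_vacuum g)).symm
  calc W.wightmanFn n k (fun i => poincareTest g (f i))
      = ⟪W.U g W.vacuum,
          W.U g (W.fieldMonomial (List.ofFn fun i => (k i, f i)) W.vacuumDom : W.H)⟫_ℂ := by
        rw [WightmanData.wightmanFn, h2, hW.U_vacuum g]
    _ = W.wightmanFn n k f :=
        (W.U g).inner_map_map_of_mem_unitary (W.U_mem_unitary g) _ _

/-- **Translation invariance of the Wightman functions**:
`𝔚ₙ(f₁(· - a), …, fₙ(· - a)) = 𝔚ₙ(f₁, …, fₙ)` (Streater–Wightman (1964), §3-3, eq. (3-21), from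
W2 and the invariance of `Ω`). This is the shape in which `constructive-qft.S05` refers to the
Wightman axioms; it is the special case `g = (a, 1)` of `wightmanFn_poincare_invariant`. [cite: StreaterWightman1964] -/
theorem wightmanFn_transl_invariant (hW : IsWightmanQFT W) (n : ℕ) (k : Fin n → κ)
    (f : Fin n → 𝓢(SpaceTime d, ℂ)) (a : SpaceTime d) :
    W.wightmanFn n k
        (fun i => poincareTest (SemidirectProduct.inl (Multiplicative.ofAdd a)) (f i)) =
      W.wightmanFn n k f :=
  hW.wightmanFn_poincare_invariant n k f _

/-- **Hermiticity of the Wightman functions**: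
`conj 𝔚ₙ(f₁, …, fₙ) = 𝔚ₙ(f̄ₙ, …, f̄₁)` with the field labels reversed
(Streater–Wightman (1964), §3-3, eq. (3-25), from the hermiticity of the fields). [cite: StreaterWightman1964] -/
def wightmanFn_hermitian : Prop :=
  ∀ (hW : IsWightmanQFT W) (n : ℕ) (k : Fin n → κ) (f : Fin n → 𝓢(SpaceTime d, ℂ)),
    conj (W.wightmanFn n k f) =
      W.wightmanFn n (fun i => k (Fin.rev i)) (fun i => QuantumLattice.starTest (f (Fin.rev i)))

/-- **Positivity of the energy**: under the Wightman axioms the Hamiltonian of the time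
translations `U(t e₀, 1) = e^{itH}` is positive, `H ≥ 0` (the spectral condition
`supp E ⊆ V̄₊` implies `p⁰ ≥ 0`; Streater–Wightman (1964), §3-1; via G07's
`hasPositiveEnergy_iff_hasFourierSpectrumIn_Ici`). [cite: StreaterWightman1964] -/
def hasPositiveEnergy : Prop :=
  ∀ (hW : IsWightmanQFT W),
    W.transl.timeTranslations.HasPositiveEnergy

/-- Under the Wightman axioms, a mass gap of the time translations already gives
`WightmanData.HasMassGap` (the unique-vacuum half is axiom W0). [folklore] -/
theorem hasMassGap_iff (hW : IsWightmanQFT W) (Δ : ℝ) :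
    W.HasMassGap Δ ↔ W.transl.timeTranslations.HasMassGap W.vacuum Δ :=
  ⟨fun h => h.2, fun h => ⟨hW.uniqueVacuum, h⟩⟩

end IsWightmanQFT

end Literature.MathematicalPhysics.QuantumLattice
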